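import Literature.NumberTheory.Rogawski1990.ArchSchwartzOrbitalIntegralConvergence   -- ★ p848470 LH3-p04 (g0): §1 `integrable_of_norm_mul_weight_le_of_dyadic_volume`, §2 `tsum_dyadic_volume_ne_top_of_polynomialGrowth`
import Literature.NumberTheory.Automorphic.ArchHSGLLowerBound                        -- ★ (C) LH2-p02 (g2): `one_le_archHSGL_arch` (radius `≥ 1` on `U(J)(L⁺ ⊗ ℝ)`), `isUnit_antidiagOne_det` through it
import HarnessLib

/-!
# Orbital integrands of archimedean Schwartz functions are integrable given polynomial volume growth — GENERIC CARRIER, and the instances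
# `U(J)(L⁺ ⊗ ℝ)` (`G_∞ = U(Φ₃)(L⁺ ⊗ ℝ) = U(2,1)^d`, `G′_∞ = U(H)(L⁺ ⊗ ℝ)`; Ξ-exponent `e = 1` on the `U(2,1)`-carriers)

Topic `NumberTheory/Rogawski1990`; namespace `Literature.NumberTheory.Rogawski1990`.  THEOREMS ONLY (no `def`, no instance, no notation, no axiom, no named fact,
no `sorry`).  Cell `pub/hodgecm-mathlib`, crux H413 (`stmt-HodgeConjecture-24833`), programme F0∕P3c «GO 500» half A: DEAL #13 (A) «(CONV-gen)» of LH3-plan (g0) to seat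
LH2-p02 (g2).  SIBLING of ★ `ArchSchwartzOrbitalIntegralConvergence` (p848470, LH3-p04 (g0)): that file proves the abstract dyadic lemma (§1), the summability of
the dyadic series under polynomial volume growth (§2) and the (CONV) statement for the ONE carrier `ι_∞ : H_∞ ↪ GL₃(L ⊗ ℝ)` (§3); THIS file re-proves nothing of it
and states §3 with the CARRIER A PARAMETER — any topological group `X` with a continuous map `ι : X → GL_N(L ⊗ ℝ)` of radius `archHSGL ∘ ι ≥ 1` — and then
instantiates it at the tree's archimedean unitary groups ★ `UnitaryGroup.arch … N J` (`ι` = the inclusion, radius `≥ 1` by ★ `one_le_archHSGL_arch`: `|det k_w| = 1`,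
Hadamard, AM–GM), i.e. at `G_∞`, `G′_∞` of line LH2 (`stub_N8`: letters O1″ «Shelstad, Schwartz-valued transfer», O3″ «Bouaziz replacement», both about
★ `ArchSchwartzOn L 3 Φ₃ 1`) exactly as p848470 serves `H_∞` of line LH3 (`stub_N9`).

THE MATHEMATICS ([BeuzartPlessis2020Asterisque, §1.5 (1.5.2)–(1.5.3) p. 31]; Harish-Chandra).  Let `g = φ ∘ ι` be Schwartz in the sense of ★ `ArchSchwartzGL L N 𝔩 e ι g`:
`φ` right-smooth on `GL_N(L ⊗ ℝ)` and, at the empty words, `|g(x)| · P(x)^e · (1 + log P(x))^d ≤ C_d` for every `d`, `P = archHSGL ∘ ι ≥ 1`.  Let `γ ∈ X` and `μ` a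
measure on `X ⧸ Z(γ)` with `μ{ẋ : P(x γ x⁻¹) ≤ R} ≤ A R^e (1 + log R)^m` (`R ≥ 1`).  Then `ẋ ↦ g(x γ x⁻¹)` (★ `descConj`) is `μ`-integrable: take `d = m + 2` and sum
the dyadic shells (★ p848470 §1–§2).  For the Weil-form quotient measures `dν ∕ dt` of a compatible system (★ `ArchCompatibleFamiliesG`) at a regular `γ` the volume
hypothesis is Harish-Chandra's estimate (organ (VOL), not proved here; `e = 1` on `U(2,1)`-factors: `K A⁺ K` with `Ξ(a_t)⁻¹ ≍ e^{2t} ≍ ‖a_t‖²_HS`).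

CONTENTS.  §1 `integrable_descConj_of_archSchwartzGL_of_volumeGrowth_carrier` (generic `X`, `ι`, hypothesis `hP : ∀ x, 1 ≤ archHSGL L N (ι x)`) + the
`OrbitalMeasureFamily`-member form.  §2 `U(J)(L⁺ ⊗ ℝ)`: `integrable_descConj_of_archSchwartzOn_of_volumeGrowth` (`det J ≠ 0`, `N ≥ 1`; ★ `ArchSchwartzOn L N J e`),
member form, and the `Φ_N` instances (`…_antidiagOne…`; at `N = 3`, `e = 1` this is `𝒞(G_∞) = ArchSchwartzOn L 3 Φ₃ 1` of the LH2 letters).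
HONEST LABEL: HC_CM is proved only modulo the 7 printed citations (2 remaining: hLiu418 = stmt-HodgeConjecture-24832, h413 = stmt-HodgeConjecture-24833) until
rung 0 closes; this file closes no organ — (CONV) ⟸ (VOL) for the `G`-side carriers, A3-hardening of O1″∕O3″ (the `stableOrbitalIntegralRel` of a Schwartz transfer
is an honest Bochner integral once (VOL) lands), exactly as p848470 is for O1∕O3 of `stub_N9`.

## References
* [BeuzartPlessis2020Asterisque] R. Beuzart-Plessis, *A local trace formula for the Gan–Gross–Prasad conjecture for unitary groups: the archimedean case*,
  Astérisque 418 (2020), §1.5 pp. 29–31: Prop. 1.5.1, the Schwartz space `𝒞(G(F))`, (1.5.2)–(1.5.3) (held scan `paper:doi-10-24033-ast-1120`, p0030–p0032).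
* [HarishChandra1966] Harish-Chandra, *Discrete series for semisimple Lie groups II*, Acta Math. 116 (1966), §9 (convergence of Schwartz orbital integrals).
* [Rogawski1990] J. D. Rogawski, *Automorphic Representations of Unitary Groups in Three Variables* (1990), §4.9 p. 54 (orbital integrals), Prop. 4.9.1 (a) p. 55.
-/

set_option autoImplicit false

noncomputable section

open MeasureTheory NumberField NumberField.mixedEmbedding Topology
open Literature.NumberTheory.Automorphic Literature.MeasureTheory.Group
open scoped MatrixGroups Matrix Classical ENNReal

namespace Literature.NumberTheory.Rogawski1990

/-! ## §1 Generic carrier `ι : X → GL_N(L ⊗ ℝ)` -/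

section Carrier

variable {L : Type} [Field L] [NumberField L] {N : ℕ}
  {X : Type*} [Group X] [TopologicalSpace X] [IsTopologicalGroup X]

/-- **(CONV) modulo volume growth, generic carrier.**  `X` a topological group, `ι : X → GL_N(L ⊗ ℝ)` continuous with `archHSGL ∘ ι ≥ 1`, `g ∈ 𝒞` in the sense of
★ `ArchSchwartzGL L N 𝔩 e ι g` (`e > 0`; only the empty words are used, so any `𝔩`), `γ ∈ X`, `μ` a measure on `X ⧸ Z(γ)` with
`μ{ẋ : archHSGL(ι(x γ x⁻¹)) ≤ R} ≤ A R^e (1 + log R)^m` for `R ≥ 1`.  Then `ẋ ↦ g(x γ x⁻¹)` (★ `descConj`) is `μ`-integrable (decay `|g| ≤ C_d ∕ (P^e (1 + log P)^d)` with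
`d = m + 2`, dyadic shells ★ `integrable_of_norm_mul_weight_le_of_dyadic_volume`, ★ `tsum_dyadic_volume_ne_top_of_polynomialGrowth`).
[cite: BeuzartPlessis2020Asterisque, §1.5 (1.5.2)–(1.5.3) p. 31] [cite: HarishChandra1966, §9] -/
theorem integrable_descConj_of_archSchwartzGL_of_volumeGrowth_carrier
    (𝔩 : Set (Matrix (Fin N) (Fin N) (mixedSpace L))) {e : ℝ} (he : 0 < e)
    {ι : X → GL (Fin N) (mixedSpace L)} (hι : Continuous ι) (hP : ∀ x, 1 ≤ archHSGL L N (ι x))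
    {g : X → ℂ} (hg : ArchSchwartzGL L N 𝔩 e ι g)
    (γ : X) [MeasurableSpace (X ⧸ Subgroup.centralizer ({γ} : Set X))] [BorelSpace (X ⧸ Subgroup.centralizer ({γ} : Set X))]
    (μ : Measure (X ⧸ Subgroup.centralizer ({γ} : Set X)))
    (hvol : ∃ (A : ℝ) (m : ℕ), ∀ R : ℝ, 1 ≤ R →
      μ {x | descConj γ (Subgroup.centralizer ({γ} : Set X)) (fun _ h => Subgroup.mem_centralizer_singleton_iff.1 h)
              (fun y => archHSGL L N (ι y)) x ≤ R} ≤
        ENNReal.ofReal (A * R ^ e * (1 + Real.log R) ^ m)) :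
    Integrable (descConj γ (Subgroup.centralizer ({γ} : Set X)) (fun _ h => Subgroup.mem_centralizer_singleton_iff.1 h) g) μ := by
  obtain ⟨A, m, hvol⟩ := hvol
  obtain ⟨φ, hφsm, hφf, hbd⟩ := hg
  -- continuity of `g` and of the radius
  have hgc : Continuous g := by
    have e1 : g = fun k => φ (ι k) := funext hφf
    rw [e1]
    exact (continuous_of_isArchSmooth_gl hφsm).comp hι
  have hPc : Continuous fun k : X => archHSGL L N (ι k) := by
    have h3 : Continuous (archHSGL L N) := by
      unfold archHSGL
      exact continuous_archHSWeightGL L N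
    exact h3.comp hι
  -- the Schwartz bound at the empty words, exponent `d = m + 2`
  obtain ⟨C, hC⟩ := hbd [] [] (fun _ h => nomatch h) (fun _ h => nomatch h) (m + 2)
  have hC' : ∀ k, ‖g k‖ * (archHSGL L N (ι k) ^ e * (1 + Real.log (archHSGL L N (ι k))) ^ (m + 2)) ≤ C := by
    intro k
    have h := hC k
    simp only [archTwoSidedDerivGL, iterLieDeriv_nil, inv_inv] at h
    rw [← hφf k, mul_assoc] at h
    exact h
  refine integrable_of_norm_mul_weight_le_of_dyadic_volume
    (hgc |> continuous_descConj γ _ _ |>.aestronglyMeasurable)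
    ((continuous_descConj γ _ _ hPc).measurable)
    (fun x => ?_) (w := fun r => r ^ e * (1 + Real.log r) ^ (m + 2)) (fun r hr => ?_) (fun r s hr hrs => ?_) (C := C) (fun x => ?_)
    (tsum_dyadic_volume_ne_top_of_polynomialGrowth μ _ e A m hvol)
  · -- `P ≥ 1`
    induction x using QuotientGroup.induction_on with
    | H y => exact hP _
  · -- `w > 0` on `[1, ∞)`
    have h1 : 0 < r := lt_of_lt_of_le one_pos hr
    have h2 : 0 ≤ Real.log r := Real.log_nonneg hr
    exact mul_pos (Real.rpow_pos_of_pos h1 e) (pow_pos (by linarith) _)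
  · -- `w` monotone on `[1, ∞)`
    have h1 : 0 < r := lt_of_lt_of_le one_pos hr
    have h2 : 0 ≤ Real.log r := Real.log_nonneg hr
    have h3 : Real.log r ≤ Real.log s := Real.log_le_log h1 hrs
    exact mul_le_mul (Real.rpow_le_rpow h1.le hrs he.le) (pow_le_pow_left₀ (by linarith) (by linarith) _)
      (pow_nonneg (by linarith) _) (Real.rpow_nonneg (h1.le.trans hrs) e)
  · -- the decay bound on the quotient
    induction x using QuotientGroup.induction_on with
    | H y => exact hC' _

/-- **(CONV), generic carrier, for a member of an orbital-measure family**: under the volume-growth hypothesis at the class `c`, the integrand of ★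
`classOrbitalIntegral m g c` (= ★ `orbitalIntegral (out c) g (m c)`) is integrable, so every summand of ★ `stableOrbitalIntegralRel … m g γ` over such classes is an
honest Bochner integral. [cite: BeuzartPlessis2020Asterisque, §1.5 p. 31] [cite: Rogawski1990, §4.9 p. 54; Prop. 4.9.1 (a) p. 55] -/
theorem integrable_orbitalIntegrand_of_archSchwartzGL_of_volumeGrowth_carrier
    (𝔩 : Set (Matrix (Fin N) (Fin N) (mixedSpace L))) {e : ℝ} (he : 0 < e)
    {ι : X → GL (Fin N) (mixedSpace L)} (hι : Continuous ι) (hP : ∀ x, 1 ≤ archHSGL L N (ι x))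
    {g : X → ℂ} (hg : ArchSchwartzGL L N 𝔩 e ι g)
    [∀ a : X, MeasurableSpace (X ⧸ Subgroup.centralizer ({a} : Set X))] [∀ a : X, BorelSpace (X ⧸ Subgroup.centralizer ({a} : Set X))]
    (m : OrbitalMeasureFamily X) (c : ConjClasses X)
    (hvol : ∃ (A : ℝ) (n : ℕ), ∀ R : ℝ, 1 ≤ R →
      (m c) {x | descConj (Quotient.out c) (Subgroup.centralizer ({Quotient.out c} : Set X))
              (fun _ h => Subgroup.mem_centralizer_singleton_iff.1 h) (fun y => archHSGL L N (ι y)) x ≤ R} ≤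
        ENNReal.ofReal (A * R ^ e * (1 + Real.log R) ^ n)) :
    Integrable (descConj (Quotient.out c) (Subgroup.centralizer ({Quotient.out c} : Set X))
      (fun _ h => Subgroup.mem_centralizer_singleton_iff.1 h) g) (m c) :=
  integrable_descConj_of_archSchwartzGL_of_volumeGrowth_carrier 𝔩 he hι hP hg (Quotient.out c) (m c) hvol

end Carrier

/-! ## §2 The archimedean unitary groups `U(J)(L⁺ ⊗ ℝ)` (`G_∞ = U(Φ₃)_∞`, `G′_∞ = U(H)_∞`): radius `≥ 1` by ★ `one_le_archHSGL_arch` -/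

section Arch

variable (L : Type) [Field L] [NumberField L] [IsCMField L] (N : ℕ) [NeZero N] (J : Matrix (Fin N) (Fin N) L)

variable {J} in
/-- **(CONV) modulo volume growth on `U(J)(L⁺ ⊗ ℝ)`** (`det J ≠ 0`, `N ≥ 1`): for `g ∈ 𝒞(U(J)_∞)` = ★ `ArchSchwartzOn L N J e g` (`e > 0`), `γ ∈ U(J)_∞` and a measure `μ` on
`U(J)_∞ ⧸ Z(γ)` with `μ{ẋ : archHSGL(x γ x⁻¹) ≤ R} ≤ A R^e (1 + log R)^m` (`R ≥ 1`), the orbital integrand `ẋ ↦ g(x γ x⁻¹)` is `μ`-integrable.  Radius `≥ 1` by ★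
`one_le_archHSGL_arch` (`|det k_w| = 1`, Hadamard, AM–GM).  At `J = Φ₃`, `e = 1` this is the class `ArchSchwartzOn L 3 Φ₃ 1` of the LH2 letters O1″∕O3″.
[cite: BeuzartPlessis2020Asterisque, §1.5 (1.5.2)–(1.5.3) p. 31] [cite: HarishChandra1966, §9] [cite: Rogawski1990, §4.9 Prop. 4.9.1 (a) p. 55] -/
theorem integrable_descConj_of_archSchwartzOn_of_volumeGrowth (hJ : J.det ≠ 0) {e : ℝ} (he : 0 < e)
    {g : ↥(UnitaryGroup.arch (↥(maximalRealSubfield L)) L (IsCMField.complexConj L) N J) → ℂ} (hg : ArchSchwartzOn L N J e g)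
    (γ : ↥(UnitaryGroup.arch (↥(maximalRealSubfield L)) L (IsCMField.complexConj L) N J))
    [MeasurableSpace (↥(UnitaryGroup.arch (↥(maximalRealSubfield L)) L (IsCMField.complexConj L) N J) ⧸ Subgroup.centralizer ({γ} : Set _))]
    [BorelSpace (↥(UnitaryGroup.arch (↥(maximalRealSubfield L)) L (IsCMField.complexConj L) N J) ⧸ Subgroup.centralizer ({γ} : Set _))]
    (μ : Measure (↥(UnitaryGroup.arch (↥(maximalRealSubfield L)) L (IsCMField.complexConj L) N J) ⧸ Subgroup.centralizer ({γ} : Set _)))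
    (hvol : ∃ (A : ℝ) (m : ℕ), ∀ R : ℝ, 1 ≤ R →
      μ {x | descConj γ (Subgroup.centralizer ({γ} : Set _)) (fun _ h => Subgroup.mem_centralizer_singleton_iff.1 h)
              (fun y : ↥(UnitaryGroup.arch (↥(maximalRealSubfield L)) L (IsCMField.complexConj L) N J) =>
                archHSGL L N (y : GL (Fin N) (mixedSpace L))) x ≤ R} ≤
        ENNReal.ofReal (A * R ^ e * (1 + Real.log R) ^ m)) :
    Integrable (descConj γ (Subgroup.centralizer ({γ} : Set _)) (fun _ h => Subgroup.mem_centralizer_singleton_iff.1 h) g) μ :=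
  integrable_descConj_of_archSchwartzGL_of_volumeGrowth_carrier _ he continuous_subtype_val
    (fun x => one_le_archHSGL_arch L N hJ x) hg γ μ hvol

variable {J} in
/-- **(CONV) for a member of an orbital-measure family on `U(J)(L⁺ ⊗ ℝ)`**: under the volume-growth hypothesis at the class `c` (for the Weil-form family of a
compatible system this is Harish-Chandra's estimate = organ (VOL)), the integrand of ★ `classOrbitalIntegral m g c` is integrable — every summand of
★ `stableOrbitalIntegralRel … m g γ` (★ `archStableOrbitalIntegral`) over such classes is an honest Bochner integral.
[cite: BeuzartPlessis2020Asterisque, §1.5 p. 31] [cite: Rogawski1990, §4.9 p. 54; Prop. 4.9.1 (a) p. 55] -/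
theorem integrable_orbitalIntegrand_of_archSchwartzOn_of_volumeGrowth (hJ : J.det ≠ 0) {e : ℝ} (he : 0 < e)
    {g : ↥(UnitaryGroup.arch (↥(maximalRealSubfield L)) L (IsCMField.complexConj L) N J) → ℂ} (hg : ArchSchwartzOn L N J e g)
    [∀ a : ↥(UnitaryGroup.arch (↥(maximalRealSubfield L)) L (IsCMField.complexConj L) N J),
      MeasurableSpace (↥(UnitaryGroup.arch (↥(maximalRealSubfield L)) L (IsCMField.complexConj L) N J) ⧸ Subgroup.centralizer ({a} : Set _))]
    [∀ a : ↥(UnitaryGroup.arch (↥(maximalRealSubfield L)) L (IsCMField.complexConj L) N J),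
      BorelSpace (↥(UnitaryGroup.arch (↥(maximalRealSubfield L)) L (IsCMField.complexConj L) N J) ⧸ Subgroup.centralizer ({a} : Set _))]
    (m : OrbitalMeasureFamily ↥(UnitaryGroup.arch (↥(maximalRealSubfield L)) L (IsCMField.complexConj L) N J))
    (c : ConjClasses ↥(UnitaryGroup.arch (↥(maximalRealSubfield L)) L (IsCMField.complexConj L) N J))
    (hvol : ∃ (A : ℝ) (n : ℕ), ∀ R : ℝ, 1 ≤ R →
      (m c) {x | descConj (Quotient.out c) (Subgroup.centralizer ({Quotient.out c} : Set _))
              (fun _ h => Subgroup.mem_centralizer_singleton_iff.1 h)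
              (fun y : ↥(UnitaryGroup.arch (↥(maximalRealSubfield L)) L (IsCMField.complexConj L) N J) =>
                archHSGL L N (y : GL (Fin N) (mixedSpace L))) x ≤ R} ≤
        ENNReal.ofReal (A * R ^ e * (1 + Real.log R) ^ n)) :
    Integrable (descConj (Quotient.out c) (Subgroup.centralizer ({Quotient.out c} : Set _))
      (fun _ h => Subgroup.mem_centralizer_singleton_iff.1 h) g) (m c) :=
  integrable_descConj_of_archSchwartzOn_of_volumeGrowth L N hJ he hg (Quotient.out c) (m c) hvol

/-- **The quasi-split instance `J = Φ_N`** (`G_∞ = U(Φ₃)(L⁺ ⊗ ℝ) = U(2,1)^d` at `N = 3`; the LH2 letters use `e = 1`): (CONV) modulo volume growth for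
★ `ArchSchwartzOn L N Φ_N e` (`det Φ_N` a unit, ★ `isUnit_antidiagOne_det`). [cite: BeuzartPlessis2020Asterisque, §1.5 (1.5.2)–(1.5.3) p. 31] [cite: HarishChandra1966, §9] -/
theorem integrable_descConj_of_archSchwartzOn_antidiagOne_of_volumeGrowth {e : ℝ} (he : 0 < e)
    {g : ↥(UnitaryGroup.arch (↥(maximalRealSubfield L)) L (IsCMField.complexConj L) N
      (Matrix.of fun i j : Fin N => if i.val + j.val + 1 = N then (1 : L) else 0)) → ℂ}
    (hg : ArchSchwartzOn L N (Matrix.of fun i j : Fin N => if i.val + j.val + 1 = N then (1 : L) else 0) e g)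
    (γ : ↥(UnitaryGroup.arch (↥(maximalRealSubfield L)) L (IsCMField.complexConj L) N
      (Matrix.of fun i j : Fin N => if i.val + j.val + 1 = N then (1 : L) else 0)))
    [MeasurableSpace (↥(UnitaryGroup.arch (↥(maximalRealSubfield L)) L (IsCMField.complexConj L) N
      (Matrix.of fun i j : Fin N => if i.val + j.val + 1 = N then (1 : L) else 0)) ⧸ Subgroup.centralizer ({γ} : Set _))]
    [BorelSpace (↥(UnitaryGroup.arch (↥(maximalRealSubfield L)) L (IsCMField.complexConj L) N
      (Matrix.of fun i j : Fin N => if i.val + j.val + 1 = N then (1 : L) else 0)) ⧸ Subgroup.centralizer ({γ} : Set _))]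
    (μ : Measure (↥(UnitaryGroup.arch (↥(maximalRealSubfield L)) L (IsCMField.complexConj L) N
      (Matrix.of fun i j : Fin N => if i.val + j.val + 1 = N then (1 : L) else 0)) ⧸ Subgroup.centralizer ({γ} : Set _)))
    (hvol : ∃ (A : ℝ) (m : ℕ), ∀ R : ℝ, 1 ≤ R →
      μ {x | descConj γ (Subgroup.centralizer ({γ} : Set _)) (fun _ h => Subgroup.mem_centralizer_singleton_iff.1 h)
              (fun y : ↥(UnitaryGroup.arch (↥(maximalRealSubfield L)) L (IsCMField.complexConj L) N
                  (Matrix.of fun i j : Fin N => if i.val + j.val + 1 = N then (1 : L) else 0)) =>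
                archHSGL L N (y : GL (Fin N) (mixedSpace L))) x ≤ R} ≤
        ENNReal.ofReal (A * R ^ e * (1 + Real.log R) ^ m)) :
    Integrable (descConj γ (Subgroup.centralizer ({γ} : Set _)) (fun _ h => Subgroup.mem_centralizer_singleton_iff.1 h) g) μ :=
  integrable_descConj_of_archSchwartzOn_of_volumeGrowth L N (UnitaryGroup.isUnit_antidiagOne_det L N).ne_zero he hg γ μ hvol

/-- **`J = Φ_N`, member of an orbital-measure family** (the shape ★ `archStableOrbitalIntegral L 3 Φ₃ m a γ` sums at `N = 3`): the orbital integrand of a Schwartz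
`g ∈ ArchSchwartzOn L N Φ_N e` at the class `c` is `(m c)`-integrable under the volume-growth hypothesis at `c`.
[cite: BeuzartPlessis2020Asterisque, §1.5 p. 31] [cite: Rogawski1990, §4.9 p. 54; §14.2 (14.2.1) p. 232] -/
theorem integrable_orbitalIntegrand_of_archSchwartzOn_antidiagOne_of_volumeGrowth {e : ℝ} (he : 0 < e)
    {g : ↥(UnitaryGroup.arch (↥(maximalRealSubfield L)) L (IsCMField.complexConj L) N
      (Matrix.of fun i j : Fin N => if i.val + j.val + 1 = N then (1 : L) else 0)) → ℂ}
    (hg : ArchSchwartzOn L N (Matrix.of fun i j : Fin N => if i.val + j.val + 1 = N then (1 : L) else 0) e g)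
    [∀ a : ↥(UnitaryGroup.arch (↥(maximalRealSubfield L)) L (IsCMField.complexConj L) N
        (Matrix.of fun i j : Fin N => if i.val + j.val + 1 = N then (1 : L) else 0)),
      MeasurableSpace (↥(UnitaryGroup.arch (↥(maximalRealSubfield L)) L (IsCMField.complexConj L) N
        (Matrix.of fun i j : Fin N => if i.val + j.val + 1 = N then (1 : L) else 0)) ⧸ Subgroup.centralizer ({a} : Set _))]
    [∀ a : ↥(UnitaryGroup.arch (↥(maximalRealSubfield L)) L (IsCMField.complexConj L) N
        (Matrix.of fun i j : Fin N => if i.val + j.val + 1 = N then (1 : L) else 0)),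
      BorelSpace (↥(UnitaryGroup.arch (↥(maximalRealSubfield L)) L (IsCMField.complexConj L) N
        (Matrix.of fun i j : Fin N => if i.val + j.val + 1 = N then (1 : L) else 0)) ⧸ Subgroup.centralizer ({a} : Set _))]
    (m : OrbitalMeasureFamily ↥(UnitaryGroup.arch (↥(maximalRealSubfield L)) L (IsCMField.complexConj L) N
      (Matrix.of fun i j : Fin N => if i.val + j.val + 1 = N then (1 : L) else 0)))
    (c : ConjClasses ↥(UnitaryGroup.arch (↥(maximalRealSubfield L)) L (IsCMField.complexConj L) N
      (Matrix.of fun i j : Fin N => if i.val + j.val + 1 = N then (1 : L) else 0)))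
    (hvol : ∃ (A : ℝ) (n : ℕ), ∀ R : ℝ, 1 ≤ R →
      (m c) {x | descConj (Quotient.out c) (Subgroup.centralizer ({Quotient.out c} : Set _))
              (fun _ h => Subgroup.mem_centralizer_singleton_iff.1 h)
              (fun y : ↥(UnitaryGroup.arch (↥(maximalRealSubfield L)) L (IsCMField.complexConj L) N
                  (Matrix.of fun i j : Fin N => if i.val + j.val + 1 = N then (1 : L) else 0)) =>
                archHSGL L N (y : GL (Fin N) (mixedSpace L))) x ≤ R} ≤
        ENNReal.ofReal (A * R ^ e * (1 + Real.log R) ^ n)) :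
    Integrable (descConj (Quotient.out c) (Subgroup.centralizer ({Quotient.out c} : Set _))
      (fun _ h => Subgroup.mem_centralizer_singleton_iff.1 h) g) (m c) :=
  integrable_orbitalIntegrand_of_archSchwartzOn_of_volumeGrowth L N (UnitaryGroup.isUnit_antidiagOne_det L N).ne_zero he hg m c hvol

end Arch

end Literature.NumberTheory.Rogawski1990

end
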